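import Summits.CriticalPhenomena.PercolationContinuityZ3.Theorems.PercNearOneGluingNoHeavyLowerTailSahiCutPoint

/-!
# `NoHeavyLowerTail` (crux stmt-CriticalPhenomena-4575), Sahi programme P1: examples for the cut-point theorem

Support file (Sahi cell, seat `prim-sahi-p1`, generation 3; `--supports stmt-CriticalPhenomena-4575`).

Two consequences of `SahiCutPoint.sahiPositive_of_cutPoint` (settledness — every FKG probability weight Sahi-positive of
every order — is preserved under gluing two lattices at a cut point):

* `sahiPositive_sumLex_of_cutPoint`: the ordinal sum `α ⊕ₗ β` is the gluing of `α` and `WithBot β` at `⊤_α`; this recovers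
  `SahiOrdinalSum.sahiPositive_sumLex` up to the `WithBot` step and documents that the cut-point theorem contains it.
* `sahiPositive_cubeGlueCube`: **two Boolean cubes `2³` glued top-to-bottom are settled.**  This `15`-element distributive
  lattice (`J = 3 ⊕ 3`, six join-irreducibles forming an antichain of three below an antichain of three) is NOT covered by the
  earlier closure theorems: it is not planar (`width J = 3`), has more than three join-irreducibles, and is not an ordinal sum
  `α ⊕ₗ β` of two lattices (removing the glue point from either side leaves a non-lattice).  It is realised without new
  definitions as any sublattice of `2³ × 2³` with carrier `{(p, q) | q ≠ ⊥ → p = ⊤}` (`exists_cubeGlueCube` shows the carrier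
  is indeed a sublattice), with cut point `(⊤, ⊥)`, lower block `(·, ⊥)` and upper block `(⊤, ·)`; both blocks are `2³`,
  settled by `SahiCubeAllOrders.sahiPositive_cube_three`.
-/

namespace Summit.CriticalPhenomena.PercolationContinuityZ3.Theorems.SahiCutPoint

open Finset Function Literature.Combinatorics.Sahi2008
open scoped BigOperators

noncomputable section

/-! ## The ordinal sum as a gluing -/

section OrdinalSum

/-- **The ordinal sum as a special case**: `α ⊕ₗ β` (finite lattices, `α` with a top, `β` with a bottom) has the cut point
`inl ⊤_α`, whose lower block is `α` and whose upper block is `WithBot β`; so settledness of `α` and of `WithBot β` gives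
settledness of `α ⊕ₗ β`. [this work] -/
theorem sahiPositive_sumLex_of_cutPoint {α' β' : Type*} [DistribLattice α'] [Fintype α'] [DecidableEq α'] [OrderTop α']
    [DistribLattice β'] [Fintype β'] [DecidableEq β'] [OrderBot β']
    (hα : ∀ ν : α' → ℝ, IsFKGMeasure ν → ∀ n, SahiPositive ν n)
    (hβ : ∀ ν : WithBot β' → ℝ, IsFKGMeasure ν → ∀ n, SahiPositive ν n)
    {μ : α' ⊕ₗ β' → ℝ} (hμ : IsFKGMeasure μ) (n : ℕ) : SahiPositive μ n := by
  classical
  refine sahiPositive_of_cutPoint (Sum.inlₗ ⊤ : α' ⊕ₗ β') (fun y => ?_) (fun a : α' => (Sum.inlₗ a : α' ⊕ₗ β'))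
    (fun a a' => Sum.Lex.inl_le_inl_iff) (fun y => ?_)
    (fun b : WithBot β' => WithBot.recBotCoe (Sum.inlₗ ⊤ : α' ⊕ₗ β') (fun b => Sum.inrₗ b) b) (fun b b' => ?_)
    (fun y => ?_) hα hβ hμ n
  · -- comparability with the cut point
    obtain ⟨y, rfl⟩ := toLex.surjective y
    rcases y with a | b
    · exact Or.inl (Sum.Lex.inl_le_inl_iff.2 le_top)
    · exact Or.inr (Sum.Lex.inl_le_inr _ _)
  · -- range of the lower block
    obtain ⟨y, rfl⟩ := toLex.surjective y
    rcases y with a | b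
    · exact ⟨fun _ => ⟨a, rfl⟩, fun _ => Sum.Lex.inl_le_inl_iff.2 le_top⟩
    · exact ⟨fun h => absurd h Sum.Lex.not_inr_le_inl,
        fun ⟨a, ha⟩ => absurd ha fun h => Sum.inl_ne_inr (toLex.injective h)⟩
  · -- the upper block is an order embedding
    induction b using WithBot.recBotCoe <;> induction b' using WithBot.recBotCoe
    · simp
    · simp only [WithBot.recBotCoe_bot, WithBot.recBotCoe_coe, bot_le, iff_true]
      exact Sum.Lex.inl_le_inr _ _
    · simp only [WithBot.recBotCoe_bot, WithBot.recBotCoe_coe, WithBot.coe_ne_bot, le_bot_iff, iff_false]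
      exact Sum.Lex.not_inr_le_inl
    · simp only [WithBot.recBotCoe_coe, WithBot.coe_le_coe]
      exact Sum.Lex.inr_le_inr_iff
  · -- range of the upper block
    obtain ⟨y, rfl⟩ := toLex.surjective y
    rcases y with a | b
    · constructor
      · intro h
        exact ⟨⊥, by rw [WithBot.recBotCoe_bot]; exact le_antisymm h (Sum.Lex.inl_le_inl_iff.2 le_top)⟩
      · rintro ⟨b, hb⟩
        induction b using WithBot.recBotCoe
        · rw [WithBot.recBotCoe_bot] at hb; exact hb.le
        · rw [WithBot.recBotCoe_coe] at hb
          exact absurd hb fun h => Sum.inr_ne_inl (toLex.injective h)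
    · exact ⟨fun _ => ⟨(b : WithBot β'), WithBot.recBotCoe_coe _ _ _⟩, fun _ => Sum.Lex.inl_le_inr _ _⟩

end OrdinalSum

/-! ## Two cubes glued top-to-bottom -/

section CubeGlueCube

/-- The carrier `{(p, q) ∈ 2³ × 2³ | q ≠ ⊥ → p = ⊤}` (down-sets of the poset `3 ⊕ 3`) is a sublattice of `2³ × 2³`:
a witness that the hypothesis of `sahiPositive_cubeGlueCube` is satisfiable. [this work] -/
theorem exists_cubeGlueCube :
    ∃ S : Sublattice ((Fin 3 → Bool) × (Fin 3 → Bool)),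
      ∀ p : (Fin 3 → Bool) × (Fin 3 → Bool), p ∈ S ↔ (p.2 ≠ ⊥ → p.1 = ⊤) := by
  refine ⟨⟨{p | p.2 ≠ ⊥ → p.1 = ⊤}, ?_, ?_⟩, fun p => Iff.rfl⟩
  · intro p hp q hq h
    simp only [Set.mem_setOf_eq, Prod.snd_sup, Prod.fst_sup, ne_eq] at hp hq h ⊢
    by_cases h2 : p.2 = ⊥
    · have hq2 : q.2 ≠ ⊥ := fun hq2 => h (by rw [h2, hq2, bot_sup_eq])
      rw [hq hq2, sup_top_eq]
    · rw [hp h2, top_sup_eq]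
  · intro p hp q hq h
    simp only [Set.mem_setOf_eq, Prod.snd_inf, Prod.fst_inf, ne_eq] at hp hq h ⊢
    have hp2 : p.2 ≠ ⊥ := fun h2 => h (by rw [h2, bot_inf_eq])
    have hq2 : q.2 ≠ ⊥ := fun h2 => h (by rw [h2, inf_bot_eq])
    rw [hp hp2, hq hq2, top_inf_eq]

/-- **Two Boolean cubes glued top-to-bottom are settled.**  For every sublattice `S` of `2³ × 2³` with carrier
`{(p, q) | q ≠ ⊥ → p = ⊤}` (a `15`-element distributive lattice: the lower cube `(·, ⊥)` and the upper cube `(⊤, ·)` glued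
at `(⊤, ⊥)`; join-irreducibles `3 ⊕ 3`, width `3`), every FKG probability weight on `S` is Sahi-positive of every order.
[this work] -/
theorem sahiPositive_cubeGlueCube (S : Sublattice ((Fin 3 → Bool) × (Fin 3 → Bool)))
    (hS : ∀ p : (Fin 3 → Bool) × (Fin 3 → Bool), p ∈ S ↔ (p.2 ≠ ⊥ → p.1 = ⊤)) [Fintype S] {μ : S → ℝ} (hμ : IsFKGMeasure μ) (n : ℕ) : SahiPositive μ n := by
  classical
  have hx : ((⊤, ⊥) : (Fin 3 → Bool) × (Fin 3 → Bool)) ∈ S := (hS _).2 fun h => absurd rfl h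
  have hlo : ∀ a : Fin 3 → Bool, ((a, ⊥) : (Fin 3 → Bool) × (Fin 3 → Bool)) ∈ S := fun a => (hS _).2 fun h => absurd rfl h
  have hhi : ∀ b : Fin 3 → Bool, ((⊤, b) : (Fin 3 → Bool) × (Fin 3 → Bool)) ∈ S := fun b => (hS _).2 fun _ => rfl
  refine sahiPositive_of_cutPoint (L := S) ⟨(⊤, ⊥), hx⟩ (fun y => ?_) (fun a : Fin 3 → Bool => (⟨(a, ⊥), hlo a⟩ : S))
    (fun a a' => ?_) (fun y => ?_) (fun b : Fin 3 → Bool => (⟨(⊤, b), hhi b⟩ : S)) (fun b b' => ?_) (fun y => ?_)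
    (fun ν hν n => SahiCubeAllOrders.sahiPositive_cube_three hν n)
    (fun ν hν n => SahiCubeAllOrders.sahiPositive_cube_three hν n) hμ n
  · -- `(⊤, ⊥)` is a cut point
    obtain ⟨⟨p, q⟩, hy⟩ := y
    by_cases hq : q = ⊥
    · left
      subst hq
      change ((p, (⊥ : Fin 3 → Bool)) : (Fin 3 → Bool) × (Fin 3 → Bool)) ≤ (⊤, ⊥)
      exact ⟨le_top, le_rfl⟩
    · right
      have hp : p = ⊤ := (hS _).1 hy hq
      subst hp
      change (((⊤ : Fin 3 → Bool), (⊥ : Fin 3 → Bool)) : (Fin 3 → Bool) × (Fin 3 → Bool)) ≤ (⊤, q)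
      exact ⟨le_rfl, bot_le⟩
  · -- lower block: order embedding
    change ((a, (⊥ : Fin 3 → Bool)) : (Fin 3 → Bool) × (Fin 3 → Bool)) ≤ (a', ⊥) ↔ a ≤ a'
    exact ⟨fun h => h.1, fun h => ⟨h, le_rfl⟩⟩
  · -- lower block: range `↓x`
    obtain ⟨⟨p, q⟩, hy⟩ := y
    change ((p, q) : (Fin 3 → Bool) × (Fin 3 → Bool)) ≤ (⊤, ⊥) ↔ _
    constructor
    · intro h
      have hq : q = ⊥ := le_bot_iff.1 h.2
      subst hq
      exact ⟨p, rfl⟩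
    · rintro ⟨a, ha⟩
      have h := congrArg Subtype.val ha
      change ((a, (⊥ : Fin 3 → Bool)) : (Fin 3 → Bool) × (Fin 3 → Bool)) = (p, q) at h
      rw [← h]
      exact ⟨le_top, le_rfl⟩
  · -- upper block: order embedding
    change (((⊤ : Fin 3 → Bool), b) : (Fin 3 → Bool) × (Fin 3 → Bool)) ≤ (⊤, b') ↔ b ≤ b'
    exact ⟨fun h => h.2, fun h => ⟨le_rfl, h⟩⟩
  · -- upper block: range `↑x`
    obtain ⟨⟨p, q⟩, hy⟩ := y
    change (((⊤ : Fin 3 → Bool), (⊥ : Fin 3 → Bool)) : (Fin 3 → Bool) × (Fin 3 → Bool)) ≤ (p, q) ↔ _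
    constructor
    · intro h
      have hp : p = ⊤ := top_le_iff.1 h.1
      subst hp
      exact ⟨q, rfl⟩
    · rintro ⟨b, hb⟩
      have h := congrArg Subtype.val hb
      change (((⊤ : Fin 3 → Bool), b) : (Fin 3 → Bool) × (Fin 3 → Bool)) = (p, q) at h
      rw [← h]
      exact ⟨le_rfl, bot_le⟩

end CubeGlueCube

end

end Summit.CriticalPhenomena.PercolationContinuityZ3.Theorems.SahiCutPoint
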